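import Literature.AlgebraicGeometry.HodgeTheory.NonCMEllipticCurveExists
import Literature.AlgebraicGeometry.HodgeTheory.HodgeGroupProductCMFactorLowDim
import Literature.AlgebraicGeometry.HodgeTheory.HodgeClassesProductSpanCMSquare
import Literature.AlgebraicGeometry.HodgeTheory.HodgeTypeExteriorProduct
import Literature.AlgebraicGeometry.HodgeTheory.WeilClassesIsogenyDescent
import Literature.AlgebraicGeometry.ComplexMultiplication.CMTypeOfSimpleSubvariety
import Literature.AlgebraicGeometry.Milne1999.CMTypeSimpleIsogenyFactors
import Literature.AlgebraicGeometry.Motives.AbelianVarietyProductDimProofs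
import Literature.NumberTheory.EllipticCurves.CMEndomorphismOfMulMemLattice
import HarnessLib

/-!
# `MoonenZarhin1999_exists_typeIV_threefold_prod_cmCurve_not_productSpan` holds (as typed)

The named fact of `HodgeTheory/HodgeGroupProductCMFactorLowDim` (cell `pub-hodge-ring2`, `motiv` axis),

  `∃ (A C : AbelianVariety ℂ), A.dim = 3 ∧ ¬ IsOfCMType A ∧ C.dim = 1 ∧ IsOfCMType C ∧ ¬ HodgeClassesProductSpan A C`,

vendors Moonen–Zarhin 1999, Thm. (0.1)(1) case (a) (a type-IV(1,1) threefold times an elliptic curve with CM by the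
same imaginary quadratic field carries Weil classes `W_k ⊂ H³(A) ⊗ H¹(C)` that are Hodge but not products of Hodge
classes of the factors).  This file PROVES THE STATEMENT AS TYPED, under the EXACT name
`Literature.AlgebraicGeometry.HodgeTheory.MoonenZarhin1999_exists_typeIV_threefold_prod_cmCurve_not_productSpan_holds`, with the witness

  `A = E × (E₀ × E₀)`, `C = E₀`,

`E` a complex elliptic curve WITHOUT complex multiplication (`NonCMCurve.exists_ellipticCurve_not_isOfCMType`, via
Riemann's theorem on the period `√2 + i`) and `E₀` an elliptic curve WITH complex multiplication `ψ₀² = -1`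
(`CMEndomorphism.exists_cmCurve_sqrt_neg`):

* `dim A = 3` (`AbelianVariety.dim_prod`);
* `A` is NOT of CM type: `E ↪ A` is a simple abelian subvariety (`isClosedImmersion_prodLift_id_zero`,
  `isSimple_of_dim_le_one`) and an abelian subvariety of a CM abelian variety is CM
  (`isOfCMType_of_isSimple_of_isClosedImmersion`, Shimura §5.1 Props. 3, 4, 6), while `E` is not
  (`not_isOfCMType_prod_of_left`);
* `C = E₀` is of CM type (`isOfCMType_of_cmCurve`);
* `¬ HodgeClassesProductSpan A E₀`: the property DESCENDS ALONG RETRACTS of the first factor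
  (`hodgeClassesProductSpan_of_retract`: for `s : A' → A`, `π : A → A'` with `π ∘ s = id`, a rational `(p,p)`-class
  `c` on `A' × C` is `(s × 1)^* (π × 1)^* c`, `(π × 1)^* c` is in the span of the product classes of `A × C`, and
  `(s × 1)^*` carries product classes `pr_A^* a ∪ pr_C^* b` to product classes `pr_{A'}^* (s^* a) ∪ pr_C^* b`), and
  `E₀` is a retract of `A = E × (E₀ × E₀)` (inclusion of / projection to the middle factor), whereas
  `HodgeClassesProductSpan E₀ E₀` FAILS (`not_hodgeClassesProductSpan_cmSquare`: the graph classes in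
  `H¹(E₀) ⊗ H¹(E₀)`, Moonen–Zarhin §3 (3.1) display (1)).

HONEST SCOPE.  The typed fact does not ask `A` to be SIMPLE (nor of type IV(1,1)); the witness here is a product,
and the failure of the product span comes from the shared factor `E₀` (`Hom(A, C) ≠ 0`: `Hg(A × C) ≠ Hg(A) × Hg(C)`,
Moonen–Zarhin §3 (3.1)), exactly as in the tree's discharge of the companion CM × CM tightness fact
`Shioda1981_exists_cmType_prod_not_productSpan` by `E₀ × E₀` (`HodgeClassesProductSpanCMSquare`).  Moonen–Zarhin's
case (a) PROPER — `A` SIMPLE of type IV(1,1) with `End⁰(A) = k` and `Hom(A, C) = 0`, exceptional classes = Weil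
classes `W_k` — is NOT what is proved here and would need the construction of such a simple threefold (Riemann's
theorem on a `k`-hermitian weight-one structure of signature `(2,1)` plus a genericity argument); it is not
claimed.  The consequences drawn from the fact in `HodgeGroupProductCMFactorLowDim`
(`exists_dim_three_not_cmType_not_hasSemisimpleHodgeGroup_of`, `…_not_hasNoTypeIVFactor_of`,
`not_forall_prod_dim_le_three_productSpan_of`) hold for this witness for the same reasons in print (`Hg(E × E₀²)`
has the torus `Hg(E₀)` as a factor; `E₀` is a type-IV factor).  Nothing here bears on HC_CM or on the summit.

## References

* [MoonenZarhin1999LowDim] B. Moonen, Yu. Zarhin, *Hodge classes on abelian varieties of low dimension*,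
  Math. Ann. 315 (1999) 711–733: Introduction (0.1)(1) case (a); §3 (3.1) and display (1).
* [Milne1999] J. S. Milne, Compositio Math. 117 (1999), §2 p. 54 (CM type).
* [Shimura1998] G. Shimura, *Abelian Varieties with Complex Multiplication and Modular Functions* (1998), §5.1
  Propositions 3, 4, 6 (abelian subvarieties of CM abelian varieties).
* [VoisinHodgeI2002] C. Voisin, *Hodge Theory and Complex Algebraic Geometry I* (2002), §7.3.2 (pull-backs are
  morphisms of Hodge structures), §11.3 (Künneth and cup product).

Provenance: Literature home (family `hodge`) of the Summits-side `CorCM/Assembly/TypeIVThreefoldProductSpanHolds` (cell `pub-hodgecm2`, COR-CM assembly; all its imports are `Literature/` but the chain itself), which `Literature/` may not import; theorems only, no named fact, no definition. Nothing here bears on `HC_CM`; no case of the Hodge conjecture is proved. Lane `lit-hodgefound` (Layer A1/A3: weight-one Hodge structures, CM and non-CM elliptic curves), seat p20.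
-/

noncomputable section

open _root_.CategoryTheory MonoidalCategory CartesianMonoidalCategory
open Literature.AlgebraicTopology.SingularHomology
open Literature.AlgebraicGeometry.Motives Literature.AlgebraicGeometry.HodgeTheory
open Literature.AlgebraicGeometry.ComplexMultiplication Literature.AlgebraicGeometry.Milne1999

namespace Literature.AlgebraicGeometry.HodgeTheory.TypeIVProduct

/-! ## §1 `HodgeClassesProductSpan` descends along retracts of the first factor -/

section Retract

variable {A A' C : AbelianVariety ℂ}

/-- **`HodgeClassesProductSpan A C` descends to a retract `A'` of `A`**: if `s : A' → A` and `π : A → A'` are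
homomorphisms with `π ∘ s = id`, and every rational `(p,p)`-class of `A × C` is in the span of the exterior
products of Hodge classes of the factors, then the same holds for `A' × C`.  For a rational `(p,p)`-class `c` on
`A' × C`: `(π × 1)^* c` is a rational `(p,p)`-class on `A × C` (pull-backs preserve rationality and Hodge types,
Voisin I §7.3.2), hence a combination of classes `pr_A^* a ∪ pr_C^* b`; applying `(s × 1)^*` gives back
`c = (s × 1)^* (π × 1)^* c` as a combination of the classes `pr_{A'}^* (s^* a) ∪ pr_C^* b`, which are product
classes of `A' × C`. [cite: VoisinHodgeI2002, §7.3.2] [cite: MoonenZarhin1999LowDim, §3 (3.1)] -/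
theorem hodgeClassesProductSpan_of_retract (s : A' ⟶ A) (π : A ⟶ A') (hs : s ≫ π = 𝟙 A')
    (h : HodgeClassesProductSpan A C) : HodgeClassesProductSpan A' C := by
  intro p c hc hpp
  have hA : IsSmoothProjective A.dim A.X := AbelianVariety.isSmoothProjective_holds
  have hA' : IsSmoothProjective A'.dim A'.X := AbelianVariety.isSmoothProjective_holds
  have hC : IsSmoothProjective C.dim C.X := AbelianVariety.isSmoothProjective_holds
  have hAC : IsSmoothProjective (A.dim + C.dim) (A.X ⊗ C.X) := IsSmoothProjective.tensor_holds hA hC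
  have hA'C : IsSmoothProjective (A'.dim + C.dim) (A'.X ⊗ C.X) := IsSmoothProjective.tensor_holds hA' hC
  -- the homomorphisms `s × 1` and `π × 1`
  set S : A'.prod C ⟶ A.prod C :=
    AbelianVariety.prodLift (AbelianVariety.fst A' C ≫ s) (AbelianVariety.snd A' C) with hSdef
  set P : A.prod C ⟶ A'.prod C :=
    AbelianVariety.prodLift (AbelianVariety.fst A C ≫ π) (AbelianVariety.snd A C) with hPdef
  have hS₁ : S ≫ AbelianVariety.fst A C = AbelianVariety.fst A' C ≫ s := AbelianVariety.prodLift_fst _ _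
  have hS₂ : S ≫ AbelianVariety.snd A C = AbelianVariety.snd A' C := AbelianVariety.prodLift_snd _ _
  have hSP : S ≫ P = 𝟙 (A'.prod C) := by
    apply AbelianVariety.prod_hom_ext
    · rw [Category.assoc, hPdef, AbelianVariety.prodLift_fst, ← Category.assoc, hS₁, Category.assoc, hs,
        Category.comp_id, Category.id_comp]
    · rw [Category.assoc, hPdef, AbelianVariety.prodLift_snd, hS₂, Category.id_comp]
  -- pull `c` back to `A × C`: a rational `(p,p)`-class, hence in the span of the product classes of `A × C`
  set c₁ : complexBetti (A.X ⊗ C.X) (2 * p) := complexBetti.map P.hom.hom.hom (2 * p) c with hc₁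
  have hc₁r : IsRationalClass c₁ := hc.map _
  have hc₁t : IsOfHodgeType (A.dim + C.dim) (A.X ⊗ C.X) (2 * p) p p c₁ :=
    hpp.map_of_isSmoothProjective hAC hA'C P.hom.hom.hom
  have hmem : c₁ ∈ Submodule.span ℂ (hodgeProductClasses A C p) := h p c₁ hc₁r hc₁t
  -- `c = (s × 1)^* c₁`
  have hback : complexBetti.map S.hom.hom.hom (2 * p) c₁ = c := by
    have e := abelianVarietyHom_map_map_apply S P c
    rw [hSP] at e
    refine e.trans ?_
    change complexBetti.map (𝟙 (A'.X ⊗ C.X)) (2 * p) c = c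
    rw [complexBetti.map_id]
    rfl
  rw [← hback]
  -- `(s × 1)^*` carries product classes of `A × C` to product classes of `A' × C`
  have hgen : ∀ x ∈ hodgeProductClasses A C p,
      complexBetti.map S.hom.hom.hom (2 * p) x ∈ Submodule.span ℂ (hodgeProductClasses A' C p) := by
    rintro x ⟨l, k, hlk, a, b, ha, ha', hb, hb', rfl⟩
    have hFx : complexBetti.map S.hom.hom.hom (2 * p)
        (cupProduct hlk (complexBetti.map (fst A.X C.X) (2 * l) a) (complexBetti.map (snd A.X C.X) (2 * k) b)) =
        cupProduct (X := ComplexPoints (A'.X ⊗ C.X)) hlk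
          (complexBetti.map S.hom.hom.hom (2 * l) (complexBetti.map (fst A.X C.X) (2 * l) a))
          (complexBetti.map S.hom.hom.hom (2 * k) (complexBetti.map (snd A.X C.X) (2 * k) b)) :=
      cupProduct_map _ hlk _ _
    have hXa : complexBetti.map S.hom.hom.hom (2 * l) (complexBetti.map (fst A.X C.X) (2 * l) a) =
        complexBetti.map (fst A'.X C.X) (2 * l) (complexBetti.map s.hom.hom.hom (2 * l) a) := by
      have e := abelianVarietyHom_map_map_apply S (AbelianVariety.fst A C) a
      rw [hS₁, ← abelianVarietyHom_map_map_apply] at e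
      exact e
    have hYb : complexBetti.map S.hom.hom.hom (2 * k) (complexBetti.map (snd A.X C.X) (2 * k) b) =
        complexBetti.map (snd A'.X C.X) (2 * k) b := by
      have e := abelianVarietyHom_map_map_apply S (AbelianVariety.snd A C) b
      rw [hS₂] at e
      exact e
    rw [hFx, hXa, hYb]
    exact Submodule.subset_span ⟨l, k, hlk, complexBetti.map s.hom.hom.hom (2 * l) a, b, ha.map _,
      ha'.map_of_isSmoothProjective hA' hA _, hb, hb', rfl⟩
  refine Submodule.span_induction (p := fun x _ ↦
      complexBetti.map S.hom.hom.hom (2 * p) x ∈ Submodule.span ℂ (hodgeProductClasses A' C p)) hgen ?_ ?_ ?_ hmem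
  · rw [map_zero]
    exact Submodule.zero_mem _
  · intro x y _ _ hx hy
    rw [map_add]
    exact Submodule.add_mem _ hx hy
  · intro t x _ hx
    rw [map_smul]
    exact Submodule.smul_mem _ t hx

end Retract

/-! ## §2 A product with a non-CM elliptic curve is not of CM type -/

/-- **`E × B` is not of CM type if the elliptic curve `E` is not**: `E ↪ E × B` (`(𝟙, 0)`, a closed immersion,
`isClosedImmersion_prodLift_id_zero`) is a simple abelian subvariety (`isSimple_of_dim_le_one`), and an abelian
subvariety of a CM abelian variety is of CM type (Shimura §5.1 Props. 3, 4, 6,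
`isOfCMType_of_isSimple_of_isClosedImmersion`). [cite: Shimura1998, §5.1 Propositions 3, 4, 6] [cite: Milne1999, §2 p. 54] -/
theorem not_isOfCMType_prod_of_left {E B : AbelianVariety ℂ} (hE1 : E.dim = 1) (hE : ¬ IsOfCMType E) :
    ¬ IsOfCMType (E.prod B) := by
  intro h
  haveI := AbelianVariety.isClosedImmersion_prodLift_id_zero E B
  exact hE (isOfCMType_of_isSimple_of_isClosedImmersion h (AbelianVariety.isSimple_of_dim_le_one hE1.le)
    (AbelianVariety.prodLift (𝟙 E) (0 : E ⟶ B)))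

/-! ## §3 The witness `A = E × (E₀ × E₀)`, `C = E₀` -/

/-- **The middle factor `E₀` is a retract of `E × (E₀ × E₀)`**: `(0, (𝟙, 0)) ≫ (pr₂ ≫ pr₁) = 𝟙`. [cite: MoonenZarhin1999LowDim, (0.1)(1) case (a) and §3 (3.1)] -/
theorem middle_retract (E E₀ : AbelianVariety ℂ) :
    AbelianVariety.prodLift (0 : E₀ ⟶ E) (AbelianVariety.prodLift (𝟙 E₀) (0 : E₀ ⟶ E₀)) ≫
        (AbelianVariety.snd E (E₀.prod E₀) ≫ AbelianVariety.fst E₀ E₀) = 𝟙 E₀ := by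
  rw [← Category.assoc, AbelianVariety.prodLift_snd, AbelianVariety.prodLift_fst]

/-- **For a non-CM elliptic curve `E` and a CM elliptic curve `E₀` (`ψ₀² = -d`), the Hodge classes of
`(E × (E₀ × E₀)) × E₀` are NOT spanned by exterior products of Hodge classes of the two factors** — else, by
descent along the retract `E₀` of `E × (E₀ × E₀)`, those of `E₀ × E₀` would be, contradicting
`not_hodgeClassesProductSpan_cmSquare` (the graph classes in `H¹(E₀) ⊗ H¹(E₀)`).
[cite: MoonenZarhin1999LowDim, §3 (3.1) and display (1)] -/
theorem not_hodgeClassesProductSpan_prod_cmSquare_cmCurve (E : AbelianVariety ℂ) {E₀ : AbelianVariety ℂ} {d : ℕ}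
    {ψ₀ : E₀ ⟶ E₀} (hE₀ : E₀.dim = 1) (hd : 0 < d) (hψ : ψ₀ ≫ ψ₀ = -(d • 𝟙 E₀)) :
    ¬ HodgeClassesProductSpan (E.prod (E₀.prod E₀)) E₀ := fun h ↦
  not_hodgeClassesProductSpan_cmSquare hE₀ hd hψ (hodgeClassesProductSpan_of_retract _ _ (middle_retract E E₀) h)

/-- **`MoonenZarhin1999_exists_typeIV_threefold_prod_cmCurve_not_productSpan` holds, AS TYPED**: there are a complex
abelian THREEFOLD `A` NOT of CM type and an elliptic curve `C` OF CM type with `¬ HodgeClassesProductSpan A C` —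
witnessed by `A = E × (E₀ × E₀)`, `C = E₀`, for `E` an elliptic curve without complex multiplication
(`NonCMCurve.exists_ellipticCurve_not_isOfCMType`: `End⁰(E) = ℚ`, from Riemann's theorem on the period `√2 + i`)
and `E₀` an elliptic curve with `ψ₀² = -1` (`CMEndomorphism.exists_cmCurve_sqrt_neg`).  HONEST SCOPE (module
docstring): the typed statement does not require `A` simple; the failure of the product span comes from the shared
factor `E₀` (Moonen–Zarhin §3 (3.1): `Hg(A × C) ≠ Hg(A) × Hg(C)` when `Hom(A, C) ≠ 0`), not from Weil classes on a
SIMPLE type-IV(1,1) threefold, which is Moonen–Zarhin's case (a) proper and is not constructed here.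
[cite: MoonenZarhin1999LowDim, Introduction (0.1)(1) case (a); §3 (3.1) and display (1)] [cite: Milne1999, §2 p. 54] -/
theorem _root_.Literature.AlgebraicGeometry.HodgeTheory.MoonenZarhin1999_exists_typeIV_threefold_prod_cmCurve_not_productSpan_holds :
    MoonenZarhin1999_exists_typeIV_threefold_prod_cmCurve_not_productSpan := by
  obtain ⟨E, hE1, -, -, hEcm⟩ := NonCMCurve.exists_ellipticCurve_not_isOfCMType
  obtain ⟨E₀, ψ₀, hE₀, hψ⟩ :=
    Literature.NumberTheory.EllipticCurves.CMEndomorphism.exists_cmCurve_sqrt_neg 1 one_pos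
  refine ⟨E.prod (E₀.prod E₀), E₀, ?_, not_isOfCMType_prod_of_left hE1 hEcm, hE₀,
    isOfCMType_of_cmCurve hE₀ one_pos hψ, not_hodgeClassesProductSpan_prod_cmSquare_cmCurve E hE₀ one_pos hψ⟩
  rw [AbelianVariety.dim_prod, AbelianVariety.dim_prod, hE1, hE₀]

/-- **A non-CM threefold whose Hodge group is not semisimple exists, granted Gordon's splitting fact** — the
consequence `exists_dim_three_not_cmType_not_hasSemisimpleHodgeGroup_of` of `HodgeGroupProductCMFactorLowDim` with
its Moonen–Zarhin input discharged. [cite: MoonenZarhin1999LowDim, §2 (2.4)(3)] [cite: Gordon1999HodgeAVSurvey, §3] -/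
theorem exists_dim_three_not_cmType_not_hasSemisimpleHodgeGroup_of_gordon
    (hG : Gordon1999_hodgeClassesProductSpan_of_semisimple) :
    ∃ A : AbelianVariety ℂ, A.dim = 3 ∧ ¬ IsOfCMType A ∧ ¬ HasSemisimpleHodgeGroup A :=
  exists_dim_three_not_cmType_not_hasSemisimpleHodgeGroup_of hG
    MoonenZarhin1999_exists_typeIV_threefold_prod_cmCurve_not_productSpan_holds

/-- **A non-CM threefold with a type-IV factor exists, granted Lombardo's splitting fact** — the consequence
`exists_dim_three_not_cmType_not_hasNoTypeIVFactor_of` with its Moonen–Zarhin input discharged.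
[cite: MoonenZarhin1999LowDim, §2 (2.3)–(2.4)] [cite: Lombardo2016, Lemma 3.4] -/
theorem exists_dim_three_not_cmType_not_hasNoTypeIVFactor_of_lombardo (hL : Lombardo2016_hodgeClassesProductSpan) :
    ∃ A : AbelianVariety ℂ, A.dim = 3 ∧ ¬ IsOfCMType A ∧ ¬ HasNoTypeIVFactor A :=
  exists_dim_three_not_cmType_not_hasNoTypeIVFactor_of hL
    MoonenZarhin1999_exists_typeIV_threefold_prod_cmCurve_not_productSpan_holds

/-- **The Hodge-group hypothesis of the `dim ≤ 3` rows of `HodgeGroupProductCMFactorLowDim` cannot be dropped**,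
now unconditionally: it is NOT true that for all `A` of dimension `≤ 3` and all CM `C` of dimension `≤ 3` the Hodge
classes of `A × C` are spanned by products (`not_forall_prod_dim_le_three_productSpan_of` with its input discharged).
[cite: MoonenZarhin1999LowDim, Introduction (0.1)(1), case (a)] -/
theorem not_forall_prod_dim_le_three_productSpan :
    ¬ ∀ (A C : AbelianVariety ℂ), A.dim ≤ 3 → IsOfCMType C → C.dim ≤ 3 → HodgeClassesProductSpan A C :=
  not_forall_prod_dim_le_three_productSpan_of
    MoonenZarhin1999_exists_typeIV_threefold_prod_cmCurve_not_productSpan_holds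

end Literature.AlgebraicGeometry.HodgeTheory.TypeIVProduct

end
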